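import Summits.QuantumFields.YangMills.Theorems.BalabanUVNodesN19BillFlag

/-!
# BalabanUVNodes ∕ node N19 (NE7) — THE BILL FLAG, PART II: the MOMENT LADDER (`k`-th moment letters, Markov `k = 1` … uniform modulus `k → ∞`, the moment dial), the RELATIVE
# bill flag (flag by the TWO-RUN bill, pay by its mean — no one-run factorisation at all), the Chernoff LOG-DIAL (with an exponential-moment letter the N20 weight side is FREE),
# and LINEARITY (per-block absolute letters ⇒ the mean-count letter, no independence)

Cell `pub-ymgap` (HUMAN RULING D-0062 Track A ∕ D-0149 width seats), WIDTH SEAT `pub-ymgap-dag-n19-w1` (node n19 = NE7, seat 1 of 3), generation g5, CLAIM-3 ∕ INTENT-3.  Route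
`Summits/QuantumFields/YangMills/Theses/BalabanUVNodes.lean`, key item K3⁷ `SpineGivenEndpointR13SepCoPH` (stmt-QuantumFields-20544; v5 stub 2 `stub_expansion13H`, conjuncts N19′
`KeyedCoreEdgeHolderD4` ∧ N20 `KeyedRelWeight`); filed `--kind proof --supports … --as helper`.  COUNT-NEUTRAL.  THEOREMS ONLY (0 `def`, 0 `sorry`).  ADDITIVE — imports this seat's g5
`…Theorems.BalabanUVNodesN19BillFlag` (CLAIM-1: `relWeightBound_flag_of_meanLetters`, `sum_filter_le_of_expMomentLetter`, `core_of_classFactorisation_jointBill`, `mem_sdiff_flag_iff`;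
through it p613310∕p618673 `core_of_core_cross ∕ core_cross_of_core`, dag-n19-e's `core_of_subset`, the tree's `Core ∕ HybridNE7 ∕ hybridNE7_noShell ∕ RelWeightBound`) ONLY; modifies nothing.

WHY.  CLAIM-1 priced the bill flag by the FIRST moment (Markov: a square root lost against the uniform modulus) or an exponential moment (Chernoff, weight `M e^{−θS}` left as a
condition), and stated the bill as a ONE-RUN factorisation bill although its own reading (ii) says the summable bill is the two-run RELATIVE one.  THIS FILE supplies the three
missing rungs.
* §1 [folklore] ★ `pow_mul_sum_filter_le` (`k`-th moment Markov: `S^k·Σ_{S<φ} a ≤ Σ φ^k·a`) · `sum_filter_le_of_momentLetter` · ★ `relWeightBound_flag_of_momentLetters` (N20's face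
  `{S < φ} (m∕S^k)` from `k`-th MOMENT letters; `k = 2` on a centred bill is Chebyshev) · `momentDial_eq` (`S^{k+1} = m·vol ⇒ m∕S^k = S∕vol`) · `exists_momentDial`
  (`S := (m·vol)^{1∕(k+1)}`) · ★★ `hybridNE7_billFlag_of_momentBill` (the complete binder list paid by a `k`-th moment of the bill; at the moment dial weight = radius =
  `(m_K∕vol^k)^{1∕(k+1)}` — the ladder from Markov's `√(μ∕vol)` (`k = 1`) towards the uniform modulus (`k → ∞`)).
* §2 [folklore] ★★★ `hybridNE7_relBillFlag_of_meanRelBill` — THE RELATIVE BILL FLAG: young factors matched (`Core … ∅ m_A m_B r`, `m_A > 0`), per level ONE constant `C_K` and a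
  CLASS-DEPENDENT two-run relative bill `u(τ) ≥ 0` with `e^{C_K − u}·(A·m_B) ≤ B·m_A ≤ e^{C_K + u}·(A·m_B)`, MEAN letters for `u` under both runs, a Markov dial ⇒
  `HybridNE7 … {S < u} (μ∕S) 0 0 0 (S∕vol + r)` (p618673 `core_of_core_cross` BY NAME) — no one-run factorisation, no old scalar, no uniform modulus · `relBill_uniform_of_core` (converse
  bookkeeping: a `Core` proof delivers the relative letter with the UNIFORM bill `vol·(δ + r)` — p613310 `core_cross_of_core` BY NAME).
* §3 [folklore] `logDial_weight_eq` (`M·e^{−θS} = 1∕(K+2)^2` at `S := (log M + 2 log (K+2))∕θ`) · `summable_logDial_weight` · ★★ `hybridNE7_billFlag_logDial` — with EXPONENTIAL-MOMENT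
  letters (`θ_K > 0`, `M_K ≥ 1`) the log-dial makes N20's weight `1∕(K+2)^2` WHATEVER the letters; the one condition left is the radius `Σ_K (r_K + (log M_K + 2 log (K+2))∕(θ_K vol)) < ∞`
  — by Jensen `log M_K∕θ_K ≥` the mean bill, paid WITHOUT Markov's square root.
* §4 [folklore] `card_loud_eq_sum_indicator` · ★★ `meanCount_le_of_perBlockLetters` — per-BLOCK ABSOLUTE letters (`Σ_{τ : b ∈ L τ} a ≤ p_b·Σ_T a`, the SHAPE of a per-cube
  large-field bound such as [LF-II] (1.89)) ⇒ the MEAN-COUNT letter `Σ_T |L τ|·a ≤ (Σ_b p_b)·Σ_T a` that p623522's `hybridNE7_countFlag_of_meanCount` consumes — LINEARITY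
  (`Finset.sum_comm`), no independence, no joint law, no large deviation.
READINGS (located; nothing proposed).  (i) Which moment of the (relative) LR bill a proof controls decides the exchange rate between bill and radius: first moment ⇒ square root;
`k`-th ⇒ `(k+1)`-st root of `m_k∕vol^k`; exponential ⇒ linear (+ `log K∕θ_K`).  (ii) The relative form is the one to aim letters at: it is implied by any `Core` proof (§2 converse)
and asks of the two runs only a jointly summable MEAN relative bill after the dial's root.  (iii) Nothing here is Bałaban's; no letter is claimed for the d = 4 densities.

HONEST FRAMING.  Finite-sum ∕ elementary real-series bookkeeping [folklore] over the tree's SHAPES (`Core`, `RelWeightBound`, `HybridNE7`); every factorisation ∕ relative ∕ moment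
letter is a HYPOTHESIS; nothing of Bałaban's is asserted or instantiated; no estimate of the programme is proved.  NE7 ∕ NE7b NOT PRINTED as two-run statements for d = 4 ∕ NOT
proved; N19 ∕ N20 NOT discharged; K3⁷ OPEN, not claimed, v5 untouched; counts UNMOVED (typed 28∕28 · discharged 5∕27, A 5∕28).  Everything below is PROVED (0 `sorry`, 0 named
facts, standard axioms); no decl carries a cite tag.  One finite four-torus programme at fixed ε — NOT ℝ⁴, NOT infinite volume, NOT OS, NOT a mass gap, NOT the Clay problem (R4
closes the conditional finite-𝕋⁴ rung `BalabanLadder.UV` only).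
-/

noncomputable section

open Finset
open scoped BigOperators

namespace Summit.QuantumFields.YangMills.BalabanUVNodes.N19BillFlagMoments

open Summit.QuantumFields.BalabanUV.T4Continuum.Spine.NE7 (Core)
open Literature.MathematicalPhysics.QuantumFieldTheory.Balaban1983to89
open T4WeightBudget (RelWeightBound)
open T4MatchingAssembly (HybridNE7 hybridNE7_noShell)
open Summit.QuantumFields.YangMills.BalabanUVNodes.N19CoreMetric (core_of_subset)
open Summit.QuantumFields.YangMills.BalabanUVNodes.N19RekeyingAbsorptionClassForm (core_of_core_cross)
open Summit.QuantumFields.YangMills.BalabanUVNodes.N19BillFlag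
  (relWeightBound_flag_of_meanLetters sum_filter_le_of_expMomentLetter core_of_classFactorisation_jointBill mem_sdiff_flag_iff)

/-! ## §1 The moment ladder: `k`-th moment letters (Markov `k = 1`, Chebyshev `k = 2`, …) [folklore] -/

section Moments
variable {ι : Type*} {T : Finset ι} {a φ : ι → ℝ} {S m : ℝ}

/-- **`k`-TH MOMENT MARKOV ON A FINITE WEIGHTED SUM** [folklore]: `a, φ ≥ 0` on `T`, `S ≥ 0` ⇒ `S^k · Σ_{τ ∈ T, S < φ τ} a τ ≤ Σ_{τ ∈ T} (φ τ)^k · a τ`. -/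
theorem pow_mul_sum_filter_le (ha : ∀ τ ∈ T, 0 ≤ a τ) (hφ : ∀ τ ∈ T, 0 ≤ φ τ) (hS : 0 ≤ S) (k : ℕ) :
    S ^ k * ∑ τ ∈ T.filter (fun τ => S < φ τ), a τ ≤ ∑ τ ∈ T, φ τ ^ k * a τ := by
  calc S ^ k * ∑ τ ∈ T.filter (fun τ => S < φ τ), a τ = ∑ τ ∈ T.filter (fun τ => S < φ τ), S ^ k * a τ := Finset.mul_sum _ _ _
    _ ≤ ∑ τ ∈ T.filter (fun τ => S < φ τ), φ τ ^ k * a τ := Finset.sum_le_sum fun τ hτ => by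
        obtain ⟨hT, hS'⟩ := Finset.mem_filter.mp hτ
        exact mul_le_mul_of_nonneg_right (pow_le_pow_left₀ hS hS'.le k) (ha τ hT)
    _ ≤ ∑ τ ∈ T, φ τ ^ k * a τ :=
        Finset.sum_le_sum_of_subset_of_nonneg (Finset.filter_subset _ _) fun τ hT _ => mul_nonneg (pow_nonneg (hφ τ hT) k) (ha τ hT)

/-- **THE `k`-TH MOMENT LETTER PRICES THE TAIL AT RATE `S^{−k}`** [folklore]: `Σ_T φ^k·a ≤ m·Σ_T a`, `0 < S` ⇒ `Σ_{S<φ} a ≤ (m∕S^k)·Σ_T a`. -/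
theorem sum_filter_le_of_momentLetter (ha : ∀ τ ∈ T, 0 ≤ a τ) (hφ : ∀ τ ∈ T, 0 ≤ φ τ) (hS : 0 < S) (k : ℕ)
    (hm : ∑ τ ∈ T, φ τ ^ k * a τ ≤ m * ∑ τ ∈ T, a τ) :
    ∑ τ ∈ T.filter (fun τ => S < φ τ), a τ ≤ m / S ^ k * ∑ τ ∈ T, a τ := by
  have h := (pow_mul_sum_filter_le (S := S) ha hφ hS.le k).trans hm
  rw [div_mul_eq_mul_div, le_div_iff₀ (pow_pos hS k)]
  linarith

end Moments

section MomentFace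
variable {ι : Type*} {l₀ : ℝ} {T : ℕ → Finset ι} {A B φ : ℕ → ℝ → ι → ℝ} {S m : ℕ → ℝ}

/-- **★ N20's FACE FOR A THRESHOLD FLAG FROM `k`-TH MOMENT LETTERS** [folklore]: `Σ_τ φ^k·A ≤ m_K·Σ_τ A`, `Σ_τ φ^k·B ≤ m_K·Σ_τ B` (`φ ≥ 0`, `m_K ≥ 0`, `S_K > 0`),
`m_K∕S_K^k < 1` summable ⇒ `RelWeightBound l₀ T A B {S < φ} (m∕S^k)`.  `k = 1` is CLAIM-1's Markov face; `k = 2` with `φ` a centred bill is Chebyshev. -/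
theorem relWeightBound_flag_of_momentLetters (k : ℕ)
    (hA0 : ∀ (K : ℕ) (t : ℝ), |t| ≤ l₀ → ∀ τ ∈ T K, 0 ≤ A K t τ) (hB0 : ∀ (K : ℕ) (t : ℝ), |t| ≤ l₀ → ∀ τ ∈ T K, 0 ≤ B K t τ)
    (hφ : ∀ (K : ℕ) (t : ℝ), |t| ≤ l₀ → ∀ τ ∈ T K, 0 ≤ φ K t τ)
    (hmA : ∀ (K : ℕ) (t : ℝ), |t| ≤ l₀ → ∑ τ ∈ T K, φ K t τ ^ k * A K t τ ≤ m K * ∑ τ ∈ T K, A K t τ)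
    (hmB : ∀ (K : ℕ) (t : ℝ), |t| ≤ l₀ → ∑ τ ∈ T K, φ K t τ ^ k * B K t τ ≤ m K * ∑ τ ∈ T K, B K t τ)
    (hS : ∀ K, 0 < S K) (hm0 : ∀ K, 0 ≤ m K) (hlt : ∀ K, m K / S K ^ k < 1) (hsum : Summable fun K => m K / S K ^ k) :
    RelWeightBound l₀ T A B (fun K t => (T K).filter fun τ => S K < φ K t τ) (fun K => m K / S K ^ k) where
  bad_subset _ _ _ := Finset.filter_subset _ _
  nonneg K := div_nonneg (hm0 K) (pow_nonneg (hS K).le k)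
  lt_one := hlt
  summable := hsum
  bad_left K t ht := sum_filter_le_of_momentLetter (hA0 K t ht) (hφ K t ht) (hS K) k (hmA K t ht)
  bad_right K t ht := sum_filter_le_of_momentLetter (hB0 K t ht) (hφ K t ht) (hS K) k (hmB K t ht)

/-- **THE `k`-TH MOMENT DIAL** [folklore]: a threshold with `S^{k+1} = m·vol` (`S, vol > 0`) balances weight and radius: `m∕S^k = S∕vol`. -/
theorem momentDial_eq {m S vol : ℝ} {k : ℕ} (hS : 0 < S) (hvol : 0 < vol) (h : S ^ (k + 1) = m * vol) : m / S ^ k = S / vol := by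
  rw [div_eq_div_iff (pow_pos hS k).ne' hvol.ne', ← h, pow_succ, mul_comm]

/-- … and such a threshold exists: `S := (m·vol)^{1∕(k+1)}` (`m ≥ 0`, `vol > 0`; `Real.rpow_inv_natCast_pow`). [folklore] -/
theorem exists_momentDial {m vol : ℝ} (k : ℕ) (hm : 0 ≤ m) (hvol : 0 < vol) :
    ((m * vol) ^ ((↑(k + 1) : ℝ)⁻¹)) ^ (k + 1) = m * vol ∧ 0 ≤ (m * vol) ^ ((↑(k + 1) : ℝ)⁻¹) :=
  ⟨Real.rpow_inv_natCast_pow (mul_nonneg hm hvol.le) (Nat.succ_ne_zero k), Real.rpow_nonneg (mul_nonneg hm hvol.le) _⟩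

end MomentFace

/-! ### The complete binder list from a `k`-th moment of the bill -/

section MomentBill
variable {ι : Type*} [DecidableEq ι] {l₀ vol : ℝ} {T : ℕ → Finset ι}
  {A B mA mB sA sB : ℕ → ℝ → ι → ℝ} {RA RB r S m : ℕ → ℝ}

/-- **★★ THE BILL FLAG PAID BY A `k`-TH MOMENT OF THE BILL** [folklore]: CLAIM-1's `hybridNE7_billFlag_of_meanBill` with the mean-bill letters replaced by `k`-th MOMENT letters
`Σ_τ (s_A+s_B)^k·A ≤ m_K·Σ_τ A` (and `B`), weight `m∕S^k`: `HybridNE7 … {S < s_A+s_B} (m∕S^k) 0 0 0 (r + S∕vol)`.  With the moment dial `S^{k+1} = m·vol` weight = radius =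
`(m_K∕vol^k)^{1∕(k+1)}`: the ladder `k = 1, 2, …` interpolates between Markov's square root and the uniform modulus (`k → ∞`). -/
theorem hybridNE7_billFlag_of_momentBill (k : ℕ) (hvol : 0 < vol)
    (hA : ∀ (K : ℕ) (t : ℝ), |t| ≤ l₀ → ∀ τ ∈ T K,
      Real.exp (-sA K t τ) * (mA K t τ * RA K) ≤ A K t τ ∧ A K t τ ≤ Real.exp (sA K t τ) * (mA K t τ * RA K))
    (hB : ∀ (K : ℕ) (t : ℝ), |t| ≤ l₀ → ∀ τ ∈ T K,
      Real.exp (-sB K t τ) * (mB K t τ * RB K) ≤ B K t τ ∧ B K t τ ≤ Real.exp (sB K t τ) * (mB K t τ * RB K))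
    (hmA : ∀ (K : ℕ) (t : ℝ), |t| ≤ l₀ → ∀ τ ∈ T K, 0 ≤ mA K t τ)
    (hRA : ∀ K, 0 < RA K) (hRB : ∀ K, 0 < RB K) (hm : Core l₀ vol T (fun _ _ => ∅) mA mB r)
    (hA0 : ∀ (K : ℕ) (t : ℝ), |t| ≤ l₀ → ∀ τ ∈ T K, 0 ≤ A K t τ) (hB0 : ∀ (K : ℕ) (t : ℝ), |t| ≤ l₀ → ∀ τ ∈ T K, 0 ≤ B K t τ)
    (hs0 : ∀ (K : ℕ) (t : ℝ), |t| ≤ l₀ → ∀ τ ∈ T K, 0 ≤ sA K t τ + sB K t τ)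
    (hmomA : ∀ (K : ℕ) (t : ℝ), |t| ≤ l₀ → ∑ τ ∈ T K, (sA K t τ + sB K t τ) ^ k * A K t τ ≤ m K * ∑ τ ∈ T K, A K t τ)
    (hmomB : ∀ (K : ℕ) (t : ℝ), |t| ≤ l₀ → ∑ τ ∈ T K, (sA K t τ + sB K t τ) ^ k * B K t τ ≤ m K * ∑ τ ∈ T K, B K t τ)
    (hS : ∀ K, 0 < S K) (hm0 : ∀ K, 0 ≤ m K) (hlt : ∀ K, m K / S K ^ k < 1) (hmS : Summable fun K => m K / S K ^ k)
    (hrad : Summable fun K => r K + S K / vol) :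
    HybridNE7 l₀ vol T A B (fun K t => (T K).filter fun τ => S K < sA K t τ + sB K t τ) (fun K => m K / S K ^ k)
      (fun _ _ _ => 0) (fun _ _ _ => 0) (fun _ => 0) (fun K => r K + S K / vol) := by
  have hW := relWeightBound_flag_of_momentLetters (φ := fun K t τ => sA K t τ + sB K t τ) k hA0 hB0 hs0 hmomA hmomB hS hm0 hlt hmS
  have hsub : ∀ (K : ℕ) (t : ℝ), |t| ≤ l₀ → T K \ (T K).filter (fun τ => S K < sA K t τ + sB K t τ) ⊆ T K \ ∅ :=
    fun K t _ => Finset.sdiff_subset_sdiff (Finset.Subset.refl _) (Finset.empty_subset _)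
  refine hybridNE7_noShell hW hA0 hB0 hrad
    (core_of_classFactorisation_jointBill hvol (fun K t ht τ hτ => hA K t ht τ (Finset.mem_sdiff.mp hτ).1)
      (fun K t ht τ hτ => hB K t ht τ (Finset.mem_sdiff.mp hτ).1) (fun K t ht τ hτ => ?_) (fun K t ht τ hτ => hmA K t ht τ (Finset.mem_sdiff.mp hτ).1)
      hRA hRB (core_of_subset le_rfl hsub hm))
  exact ((mem_sdiff_flag_iff (φ := fun K t τ => sA K t τ + sB K t τ)).mp hτ).2

end MomentBill


/-! ## §2 The RELATIVE bill flag: flag by the TWO-RUN bill, pay by its mean [folklore] -/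

section Relative
variable {ι : Type*} [DecidableEq ι] {l₀ vol : ℝ} {T : ℕ → Finset ι} {A B mA mB u : ℕ → ℝ → ι → ℝ} {r S μ : ℕ → ℝ}

/-- **★★★ THE RELATIVE BILL FLAG** [folklore].  p613310 §3 (`core_cross_of_core` ∕ p618673 `coreEdge_iff_coreEdge_cross`): given matched young factors, what `Core` NEEDS is only
two-run RELATIVE homogeneity of the effective old scalars.  So let the bill be the RELATIVE one: young factors `m_A > 0`, `m_B` matched on all classes (`Core … ∅ m_A m_B r`), and per
level ONE constant `C_K` with the cross products sandwiched CLASS-DEPENDENTLY, `e^{C_K − u(τ)}·(A·m_B) ≤ B·m_A ≤ e^{C_K + u(τ)}·(A·m_B)` (`u ≥ 0` = the two-run relative bill of the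
class); flag `{S_K < u}`; MEAN letters `Σ_τ u·A ≤ μ_K·Σ_τ A`, `Σ_τ u·B ≤ μ_K·Σ_τ B`; dial `S_K > 0`, `μ∕S < 1` summable, `Σ (S∕vol + r) < ∞` ⇒
`HybridNE7 l₀ vol T A B {S < u} (μ∕S) 0 0 0 (S∕vol + r)`.  No one-run factorisation, no old scalar, no uniform modulus: (Y) + a first-moment letter on the RELATIVE bill. -/
theorem hybridNE7_relBillFlag_of_meanRelBill (hvol : 0 < vol)
    (hA0 : ∀ (K : ℕ) (t : ℝ), |t| ≤ l₀ → ∀ τ ∈ T K, 0 ≤ A K t τ) (hB0 : ∀ (K : ℕ) (t : ℝ), |t| ≤ l₀ → ∀ τ ∈ T K, 0 ≤ B K t τ)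
    (hmA : ∀ (K : ℕ) (t : ℝ), |t| ≤ l₀ → ∀ τ ∈ T K, 0 < mA K t τ) (hmB : ∀ (K : ℕ) (t : ℝ), |t| ≤ l₀ → ∀ τ ∈ T K, 0 ≤ mB K t τ)
    (hm : Core l₀ vol T (fun _ _ => ∅) mA mB r)
    (hrel : ∀ K : ℕ, ∃ C : ℝ, ∀ t : ℝ, |t| ≤ l₀ → ∀ τ ∈ T K,
      Real.exp (C - u K t τ) * (A K t τ * mB K t τ) ≤ B K t τ * mA K t τ ∧ B K t τ * mA K t τ ≤ Real.exp (C + u K t τ) * (A K t τ * mB K t τ))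
    (hu0 : ∀ (K : ℕ) (t : ℝ), |t| ≤ l₀ → ∀ τ ∈ T K, 0 ≤ u K t τ)
    (hμA : ∀ (K : ℕ) (t : ℝ), |t| ≤ l₀ → ∑ τ ∈ T K, u K t τ * A K t τ ≤ μ K * ∑ τ ∈ T K, A K t τ)
    (hμB : ∀ (K : ℕ) (t : ℝ), |t| ≤ l₀ → ∑ τ ∈ T K, u K t τ * B K t τ ≤ μ K * ∑ τ ∈ T K, B K t τ)
    (hS : ∀ K, 0 < S K) (hμ0 : ∀ K, 0 ≤ μ K) (hlt : ∀ K, μ K / S K < 1) (hμS : Summable fun K => μ K / S K)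
    (hrad : Summable fun K => S K / vol + r K) :
    HybridNE7 l₀ vol T A B (fun K t => (T K).filter fun τ => S K < u K t τ) (fun K => μ K / S K)
      (fun _ _ _ => 0) (fun _ _ _ => 0) (fun _ => 0) (fun K => S K / vol + r K) := by
  have hW := relWeightBound_flag_of_meanLetters (φ := u) hA0 hB0 hu0 hμA hμB hS hμ0 hlt hμS
  have hsub : ∀ (K : ℕ) (t : ℝ), |t| ≤ l₀ → T K \ (T K).filter (fun τ => S K < u K t τ) ⊆ T K \ ∅ :=
    fun K t _ => Finset.sdiff_subset_sdiff (Finset.Subset.refl _) (Finset.empty_subset _)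
  -- the cross products are `Core`-matched at radius `S∕vol` on the kept classes (bill `u ≤ S_K` there, by the flag's definition)
  have hx : Core l₀ vol T (fun K t => (T K).filter fun τ => S K < u K t τ) (fun K t τ => A K t τ * mB K t τ) (fun K t τ => B K t τ * mA K t τ)
      (fun K => S K / vol) := by
    intro K
    obtain ⟨C, hC⟩ := hrel K
    refine ⟨C, fun t ht τ hτ => ?_⟩
    obtain ⟨hT, hle⟩ := (mem_sdiff_flag_iff (φ := u)).mp hτ
    obtain ⟨h₁, h₂⟩ := hC t ht τ hT
    have hw : 0 ≤ A K t τ * mB K t τ := mul_nonneg (hA0 K t ht τ hT) (hmB K t ht τ hT)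
    have hvS : vol * (S K / vol) = S K := mul_div_cancel₀ _ hvol.ne'
    rw [hvS]
    exact ⟨(mul_le_mul_of_nonneg_right (Real.exp_le_exp.mpr (by linarith)) hw).trans h₁,
      h₂.trans (mul_le_mul_of_nonneg_right (Real.exp_le_exp.mpr (by linarith)) hw)⟩
  exact hybridNE7_noShell hW hA0 hB0 hrad
    (core_of_core_cross hx (core_of_subset le_rfl hsub hm) (fun K t ht τ hτ => hA0 K t ht τ (Finset.mem_sdiff.mp hτ).1)
      (fun K t ht τ hτ => hmA K t ht τ (Finset.mem_sdiff.mp hτ).1))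

/-- **THE CONVERSE BOOKKEEPING** [folklore]: if the class sums ARE `Core`-matched (`Core … Bad A B δ`) and the young factors are (`Core … Bad m_A m_B r`; `A, m_A ≥ 0` on the good
classes), the relative-bill letter holds on the good classes with the UNIFORM bill `u ≡ vol·(δ_K + r_K)` (p613310 `core_cross_of_core`): the relative bill flag asks nothing that a
`Core` proof does not deliver, up to replacing a uniform bill by a mean one. -/
theorem relBill_uniform_of_core {Bad : ℕ → ℝ → Finset ι} {δ : ℕ → ℝ} (hAB : Core l₀ vol T Bad A B δ) (hm : Core l₀ vol T Bad mA mB r)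
    (hA0 : ∀ (K : ℕ) (t : ℝ), |t| ≤ l₀ → ∀ τ ∈ T K \ Bad K t, 0 ≤ A K t τ) (hmA0 : ∀ (K : ℕ) (t : ℝ), |t| ≤ l₀ → ∀ τ ∈ T K \ Bad K t, 0 ≤ mA K t τ) :
    ∀ K : ℕ, ∃ C : ℝ, ∀ t : ℝ, |t| ≤ l₀ → ∀ τ ∈ T K \ Bad K t,
      Real.exp (C - vol * (δ K + r K)) * (A K t τ * mB K t τ) ≤ B K t τ * mA K t τ ∧
        B K t τ * mA K t τ ≤ Real.exp (C + vol * (δ K + r K)) * (A K t τ * mB K t τ) :=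
  Summit.QuantumFields.YangMills.BalabanUVNodes.N19RekeyingAbsorptionClassForm.core_cross_of_core hAB hm hA0 hmA0

end Relative

/-! ## §3 The Chernoff LOG-DIAL: with an exponential-moment letter the weight side is free [folklore] -/

section LogDial
variable {ι : Type*} [DecidableEq ι] {l₀ vol : ℝ} {T : ℕ → Finset ι}
  {A B mA mB sA sB : ℕ → ℝ → ι → ℝ} {RA RB r θ M : ℕ → ℝ}

/-- The log-dial's weight: `M·e^{−θ·S} = 1∕(K+2)^2` at `S := (log M + 2·log (K+2))∕θ` (`θ > 0`, `M > 0`). [folklore] -/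
theorem logDial_weight_eq {θ M : ℝ} (hθ : 0 < θ) (hM : 0 < M) (K : ℕ) :
    M * Real.exp (-(θ * ((Real.log M + 2 * Real.log ((K : ℝ) + 2)) / θ))) = 1 / ((K : ℝ) + 2) ^ 2 := by
  have hK : 0 < (K : ℝ) + 2 := by positivity
  rw [mul_div_cancel₀ _ hθ.ne', neg_add, Real.exp_add, Real.exp_neg, Real.exp_log hM, ← mul_assoc, mul_inv_cancel₀ hM.ne', one_mul,
    show (2 : ℝ) * Real.log ((K : ℝ) + 2) = Real.log (((K : ℝ) + 2) ^ 2) by rw [Real.log_pow]; norm_num, Real.exp_neg, Real.exp_log (by positivity),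
    one_div]

/-- `Σ_K 1∕(K+2)^2 < ∞` and `1∕(K+2)^2 < 1`. [folklore] -/
theorem summable_logDial_weight : Summable (fun K : ℕ => 1 / ((K : ℝ) + 2) ^ 2) ∧ ∀ K : ℕ, 1 / ((K : ℝ) + 2) ^ 2 < 1 := by
  refine ⟨?_, fun K => ?_⟩
  · have h2 : Summable fun K : ℕ => 1 / ((K : ℝ)) ^ 2 := Real.summable_one_div_nat_pow.mpr one_lt_two
    have := (summable_nat_add_iff 2).mpr h2
    simpa [Nat.cast_add] using this
  · rw [div_lt_one (by positivity)]
    nlinarith [show (0 : ℝ) ≤ K from Nat.cast_nonneg K]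

/-- **★★ THE BILL FLAG WITH THE CHERNOFF LOG-DIAL** [folklore].  CLAIM-1's factorisation shape (moduli `s_A, s_B ≥ 0`, `m_A ≥ 0`, `R_A, R_B > 0`) + (Y) `Core … ∅ m_A m_B r` + the
EXPONENTIAL-MOMENT letters `Σ_τ e^{θ_K (s_A+s_B)}·A ≤ M_K·Σ_τ A` (and `B`) with `θ_K > 0`, `M_K ≥ 1`, at the dial `S_K := (log M_K + 2 log (K+2))∕θ_K`: the N20 weight is
`1∕(K+2)^2` WHATEVER the letters (summable, `< 1` — the weight side is free), and the only condition is on the radius: `Σ_K (r_K + S_K∕vol) < ∞`, i.e.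
`Σ_K (log M_K + 2 log (K+2))∕(θ_K·vol) < ∞` ⇒ `HybridNE7 … {S < s_A+s_B} (1∕(K+2)^2) 0 0 0 (r + S∕vol)`.  By Jensen `log M_K∕θ_K ≥` the mean bill: the Chernoff radius is the MEAN
bill's size WITHOUT the Markov square root, plus `log K∕θ_K`. -/
theorem hybridNE7_billFlag_logDial (hvol : 0 < vol)
    (hA : ∀ (K : ℕ) (t : ℝ), |t| ≤ l₀ → ∀ τ ∈ T K,
      Real.exp (-sA K t τ) * (mA K t τ * RA K) ≤ A K t τ ∧ A K t τ ≤ Real.exp (sA K t τ) * (mA K t τ * RA K))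
    (hB : ∀ (K : ℕ) (t : ℝ), |t| ≤ l₀ → ∀ τ ∈ T K,
      Real.exp (-sB K t τ) * (mB K t τ * RB K) ≤ B K t τ ∧ B K t τ ≤ Real.exp (sB K t τ) * (mB K t τ * RB K))
    (hmA : ∀ (K : ℕ) (t : ℝ), |t| ≤ l₀ → ∀ τ ∈ T K, 0 ≤ mA K t τ)
    (hRA : ∀ K, 0 < RA K) (hRB : ∀ K, 0 < RB K) (hm : Core l₀ vol T (fun _ _ => ∅) mA mB r)
    (hA0 : ∀ (K : ℕ) (t : ℝ), |t| ≤ l₀ → ∀ τ ∈ T K, 0 ≤ A K t τ) (hB0 : ∀ (K : ℕ) (t : ℝ), |t| ≤ l₀ → ∀ τ ∈ T K, 0 ≤ B K t τ)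
    (hθ : ∀ K, 0 < θ K) (hM : ∀ K, 1 ≤ M K)
    (hMA : ∀ (K : ℕ) (t : ℝ), |t| ≤ l₀ → ∑ τ ∈ T K, Real.exp (θ K * (sA K t τ + sB K t τ)) * A K t τ ≤ M K * ∑ τ ∈ T K, A K t τ)
    (hMB : ∀ (K : ℕ) (t : ℝ), |t| ≤ l₀ → ∑ τ ∈ T K, Real.exp (θ K * (sA K t τ + sB K t τ)) * B K t τ ≤ M K * ∑ τ ∈ T K, B K t τ)
    (hrad : Summable fun K => r K + (Real.log (M K) + 2 * Real.log ((K : ℝ) + 2)) / θ K / vol) :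
    HybridNE7 l₀ vol T A B (fun K t => (T K).filter fun τ => (Real.log (M K) + 2 * Real.log ((K : ℝ) + 2)) / θ K < sA K t τ + sB K t τ)
      (fun K => 1 / ((K : ℝ) + 2) ^ 2) (fun _ _ _ => 0) (fun _ _ _ => 0) (fun _ => 0)
      (fun K => r K + (Real.log (M K) + 2 * Real.log ((K : ℝ) + 2)) / θ K / vol) := by
  obtain ⟨hws, hw1⟩ := summable_logDial_weight
  have hM0 : ∀ K, 0 < M K := fun K => lt_of_lt_of_le one_pos (hM K)
  have hW : RelWeightBound l₀ T A B
      (fun K t => (T K).filter fun τ => (Real.log (M K) + 2 * Real.log ((K : ℝ) + 2)) / θ K < sA K t τ + sB K t τ) (fun K => 1 / ((K : ℝ) + 2) ^ 2) :=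
    { bad_subset := fun _ _ _ => Finset.filter_subset _ _
      nonneg := fun K => by positivity
      lt_one := hw1
      summable := hws
      bad_left := fun K t ht =>
        (sum_filter_le_of_expMomentLetter (S := (Real.log (M K) + 2 * Real.log ((K : ℝ) + 2)) / θ K) (φ := fun τ => sA K t τ + sB K t τ)
          (hA0 K t ht) (hθ K).le (hMA K t ht)).trans_eq (by rw [logDial_weight_eq (hθ K) (hM0 K) K])
      bad_right := fun K t ht =>
        (sum_filter_le_of_expMomentLetter (S := (Real.log (M K) + 2 * Real.log ((K : ℝ) + 2)) / θ K) (φ := fun τ => sA K t τ + sB K t τ)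
          (hB0 K t ht) (hθ K).le (hMB K t ht)).trans_eq (by rw [logDial_weight_eq (hθ K) (hM0 K) K]) }
  have hsub : ∀ (K : ℕ) (t : ℝ), |t| ≤ l₀ →
      T K \ (T K).filter (fun τ => (Real.log (M K) + 2 * Real.log ((K : ℝ) + 2)) / θ K < sA K t τ + sB K t τ) ⊆ T K \ ∅ :=
    fun K t _ => Finset.sdiff_subset_sdiff (Finset.Subset.refl _) (Finset.empty_subset _)
  have hcore : Core l₀ vol T (fun K t => (T K).filter fun τ => (Real.log (M K) + 2 * Real.log ((K : ℝ) + 2)) / θ K < sA K t τ + sB K t τ) A B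
      (fun K => r K + (Real.log (M K) + 2 * Real.log ((K : ℝ) + 2)) / θ K / vol) :=
    core_of_classFactorisation_jointBill (S := fun K => (Real.log (M K) + 2 * Real.log ((K : ℝ) + 2)) / θ K) hvol
      (fun K t ht τ hτ => hA K t ht τ (Finset.mem_sdiff.mp hτ).1)
      (fun K t ht τ hτ => hB K t ht τ (Finset.mem_sdiff.mp hτ).1)
      (fun K t ht τ hτ => ((mem_sdiff_flag_iff (S := fun K => (Real.log (M K) + 2 * Real.log ((K : ℝ) + 2)) / θ K)
        (φ := fun K t τ => sA K t τ + sB K t τ)).mp hτ).2)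
      (fun K t ht τ hτ => hmA K t ht τ (Finset.mem_sdiff.mp hτ).1) hRA hRB (core_of_subset le_rfl hsub hm)
  exact hybridNE7_noShell hW hA0 hB0 hrad hcore

end LogDial

/-! ## §4 From per-block ABSOLUTE letters to the mean count: linearity, no independence [folklore] -/

section Linearity
variable {ι β : Type*} [DecidableEq β] {T : Finset ι} {Bl : Finset β} {L : ι → Finset β} {a : ι → ℝ} {p : β → ℝ}

/-- **THE COUNT IS A SUM OF BLOCK INDICATORS** [folklore]: if every class's loud set lies in the block set, `|L τ| = Σ_{b ∈ Bl} [b ∈ L τ]`. -/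
theorem card_loud_eq_sum_indicator (hL : ∀ τ ∈ T, L τ ⊆ Bl) {τ : ι} (hτ : τ ∈ T) :
    ((L τ).card : ℝ) = ∑ b ∈ Bl, if b ∈ L τ then (1 : ℝ) else 0 := by
  rw [Finset.sum_ite_mem, Finset.inter_eq_right.mpr (hL τ hτ), Finset.sum_const, nsmul_eq_mul, mul_one]

/-- **★★ PER-BLOCK ABSOLUTE LETTERS ⇒ THE MEAN-COUNT LETTER, BY LINEARITY** [folklore].  Classes `τ ∈ T` with weights `a ≥ 0` and loud sets `L τ ⊆ Bl`; if for every block `b`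
the classes loud at `b` carry relative weight at most `p b` (`Σ_{τ ∈ T, b ∈ L τ} a ≤ p b · Σ_T a` — a ONE-block, ABSOLUTE letter, the shape of a per-cube large-field bound), then
the MEAN COUNT is at most `Σ_b p b`: `Σ_T |L τ|·a τ ≤ (Σ_{b ∈ Bl} p b)·Σ_T a` — the letter CLAIM-1's `hybridNE7_countFlag_of_meanCount` consumes.  No independence of the blocks,
no joint law, no large deviation: expectation is linear. -/
theorem meanCount_le_of_perBlockLetters (hL : ∀ τ ∈ T, L τ ⊆ Bl)
    (hblock : ∀ b ∈ Bl, ∑ τ ∈ T.filter (fun τ => b ∈ L τ), a τ ≤ p b * ∑ τ ∈ T, a τ) :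
    ∑ τ ∈ T, ((L τ).card : ℝ) * a τ ≤ (∑ b ∈ Bl, p b) * ∑ τ ∈ T, a τ := by
  calc ∑ τ ∈ T, ((L τ).card : ℝ) * a τ = ∑ τ ∈ T, ∑ b ∈ Bl, (if b ∈ L τ then (1 : ℝ) else 0) * a τ := by
        refine Finset.sum_congr rfl fun τ hτ => ?_
        rw [card_loud_eq_sum_indicator hL hτ, Finset.sum_mul]
    _ = ∑ b ∈ Bl, ∑ τ ∈ T, (if b ∈ L τ then (1 : ℝ) else 0) * a τ := Finset.sum_comm
    _ = ∑ b ∈ Bl, ∑ τ ∈ T.filter (fun τ => b ∈ L τ), a τ := by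
        refine Finset.sum_congr rfl fun b _ => ?_
        rw [Finset.sum_filter]
        exact Finset.sum_congr rfl fun τ _ => by split_ifs <;> simp
    _ ≤ ∑ b ∈ Bl, p b * ∑ τ ∈ T, a τ := Finset.sum_le_sum hblock
    _ = (∑ b ∈ Bl, p b) * ∑ τ ∈ T, a τ := by rw [Finset.sum_mul]

end Linearity


end Summit.QuantumFields.YangMills.BalabanUVNodes.N19BillFlagMoments
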